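import Summits.CriticalPhenomena.SAWScalingLimit.Theorems.SAWDevelopingMapObservableToSLEHullFirstCurveLawOfRangeLaw   -- not_retrace_of_mem_simple
import HarnessLib

/-!
# Crux `SAWDevelopingMap.ObservableToSLE` (stmt-CriticalPhenomena-10472) ≡ twin crux
`SAWDefectDecoherence.ObservableToSLER` (stmt-CriticalPhenomena-14005), line `hull-first-retrace`:
typed comparison `HexSimpleSubseqLimits ⇒ HexNoRetraceLimits`

Landing target:
`Summits/CriticalPhenomena/SAWScalingLimit/Theorems/SAWDevelopingMapObservableToSLEHullFirstNoRetraceOfSimple.lean`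
(`--supports stmt-CriticalPhenomena-10472`).

Two research items about probability subsequential weak limits `ν` of the curve laws of the
critical hexagonal self-avoiding walk in a Dobrushin domain `D` (mesh `s n → 0⁺`, lattice endpoints
`a (s n)`, `b (s n)` approximating the marked prime ends) occur on the two twin lines:

* item stmt-CriticalPhenomena-7148, `HexSimpleSubseqLimits` ("simplicity of subsequential limits"):
  `ν`-a.e. class is *simple* (the class of an injective curve), runs from `D.pt 0` to `D.pt 1`,
  stays in the closure of the domain and touches its frontier only at the two marked points;
* the twin line's stub N, `HexNoRetraceLimits` ("no retrace of subsequential limits"): `ν`-a.e.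
  class has no representative `γ` that *retraces*, i.e. admits times `r < u < t` with
  `γ r = γ t`, `γ u ≠ γ r` and the way back `γ '' [u, t]` inside the trace of the way out
  `γ '' [r, u]`.

This file records, as a closed implication, that the first item implies the second: a simple
class never retraces, because every representative of a simple class is flat
(`not_retrace_of_mem_simple`, from `Negative.isFlat_of_mk_mem_simple`), and an almost-everywhere
statement is weakened pointwise (`Filter.Eventually.mono`).  No use is made of the endpoint,
closure or frontier clauses of the stronger item.
-/

noncomputable section

open scoped BigOperators Topology NNReal ENNReal Classical BoundedContinuousFunction
open Filter Set MeasureTheory Metric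
open Literature.Probability.LatticeModels (HexVertex hexGraph hexCenter)
open Literature.Probability.RandomPlanarGeometry
open Literature.Probability.RandomPlanarGeometry.SAW

namespace Summit.CriticalPhenomena.SAWScalingLimit.Theorems.ObservableToSLER.HullFirst

/-- **`HexSimpleSubseqLimits ⇒ HexNoRetraceLimits`** (typed comparison of item
stmt-CriticalPhenomena-7148 with the twin hull-first stub N).  If every probability subsequential
weak limit `ν` of the critical hexagonal SAW curve laws in a Dobrushin domain is carried by the
simple classes (with the prescribed endpoints and boundary behaviour), then every such `ν` gives no
mass to the classes having a retracing representative: a simple class does not retrace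
(`not_retrace_of_mem_simple`). [folklore] -/
theorem stub_noRetraceLimits_of_hexSimpleSubseqLimits :
    (∀ (D : DobrushinDomain) (a b : ℝ → HexVertex), IsEmbEndpointApprox hexGraph hexCenter D a b →
      ∀ (s : ℕ → ℝ) (ν : Measure (CurveClass ℂ)), Tendsto s atTop (𝓝[>] 0) → IsProbabilityMeasure ν →
        (∀ f : CurveClass ℂ →ᵇ ℝ,
          Tendsto (fun n => ∫ γ, f γ.curve ∂(hexSAWLaw D.carrier (s n) (a (s n)) (b (s n)))) atTop
            (𝓝 (∫ x, f x ∂ν))) →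
        ∀ᵐ γ ∂ν, γ ∈ CurveClass.simple ∧ γ.source = D.pt 0 ∧ γ.target = D.pt 1 ∧
          γ.range ⊆ closure D.carrier ∧ γ.range ∩ frontier D.carrier ⊆ {D.pt 0, D.pt 1}) →
    ∀ (D : DobrushinDomain) (a b : ℝ → HexVertex), IsEmbEndpointApprox hexGraph hexCenter D a b →
      ∀ (s : ℕ → ℝ) (ν : Measure (CurveClass ℂ)), Tendsto s atTop (𝓝[>] 0) → IsProbabilityMeasure ν →
        (∀ f : CurveClass ℂ →ᵇ ℝ,
          Tendsto (fun n => ∫ γ, f γ.curve ∂(hexSAWLaw D.carrier (s n) (a (s n)) (b (s n)))) atTop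
            (𝓝 (∫ x, f x ∂ν))) →
        ∀ᵐ c ∂ν, ¬ ∃ γ : Curve ℂ, CurveClass.mk γ = c ∧
          ∃ r u t : unitInterval, r < u ∧ u < t ∧ γ r = γ t ∧ γ u ≠ γ r ∧
            γ '' Set.Icc u t ⊆ γ '' Set.Icc r u := by
  intro h7148 D a b hab s ν hs hν hlim
  filter_upwards [h7148 D a b hab s ν hs hν hlim] with c hc
  exact not_retrace_of_mem_simple hc.1

end Summit.CriticalPhenomena.SAWScalingLimit.Theorems.ObservableToSLER.HullFirst

end
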